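import Literature.AlgebraicGeometry.Resolution.MarkedIdealsLemmas
import Mathlib.AlgebraicGeometry.Morphisms.FiniteType
import Mathlib.Topology.JacobsonSpace
import HarnessLib

/-!
# Quasi-coherent ideal sheaves on a Jacobson scheme are determined by their stalks at closed points

Topic: `Literature/AlgebraicGeometry/Resolution`. Refinement of `le_of_forall_stalkIdeal_le` /
`ext_of_forall_stalkIdeal_eq` (`MarkedIdealsLemmas.lean`: inclusion/equality of ideal sheaves is checked on
ALL stalks). The proof there already uses only the points `U.fromSpec 𝔭` for `𝔭` a MAXIMAL ideal of the
section ring `Γ(X, U)` of an affine open `U` (membership in an ideal of a ring is checked at the localizations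
at maximal ideals, Mathlib `Ideal.le_of_localization_maximal`). This file records that sharper form and its
consequence on Jacobson schemes (EGA IV₃ §10.4: closed points are very dense; e.g. every scheme locally of
finite type over a field, Mathlib `AlgebraicGeometry.LocallyOfFiniteType.jacobsonSpace`), where the point of
`X` attached to a maximal ideal of `Γ(X, U)` is a CLOSED point of `X` (a locally closed singleton of a
Jacobson space is closed, Mathlib `isClosed_singleton_of_isLocallyClosed_singleton`):

* `le_of_forall_maximal_stalkIdeal_le` — `I ≤ J` as soon as `I_y ⊆ J_y` at every point `y = U.fromSpec 𝔭`,
  `U` affine, `𝔭 ⊂ Γ(X, U)` maximal (any scheme);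
* `mem_closedPoints_fromSpec_of_isMaximal` — on a Jacobson scheme such a `y` is a closed point;
* `le_of_forall_closedPoint_stalkIdeal_le`, `ext_of_forall_closedPoint_stalkIdeal_eq`,
  `eq_top_of_forall_closedPoint_stalkIdeal_eq_top` — **on a Jacobson scheme, inclusion / equality /
  triviality of quasi-coherent ideal sheaves is checked on the stalks at closed points**;
* `jacobsonSpace_of_locallyOfFiniteType_field` — a scheme locally of finite type over a field is Jacobson.

Requested by the Hironaka-2017 adjudication cell (`res-hironaka`, discharge lane, LIB-WANTED (L2) of
2026-08-27): the §5 sheaf-level readings (`DDSheaf`, `pTildeNegSheaf`) are controlled by their stalks, and the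
manuscript's standing assumption (37) is given at CLOSED points of `Sing(E)` only. Nothing about that
manuscript is asserted here.

Sources: A. Grothendieck, J. Dieudonné, ÉGA IV₃ §10.4 (Jacobson schemes, very dense subsets). [EGAIV3]
The Stacks Project, Jacobson spaces / schemes locally of finite type over a field. [StacksProject]
-/

noncomputable section

namespace Literature.AlgebraicGeometry.Resolution

open _root_.AlgebraicGeometry CategoryTheory TopologicalSpace Topology

universe u

variable {X : Scheme.{u}}

/-- **Inclusion of ideal sheaves is checked at the stalks of the «affine-maximal» points**: if
`I_y ⊆ J_y` for every point `y = U.fromSpec 𝔭` with `U` an affine open and `𝔭` a maximal ideal of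
`Γ(X, U)`, then `I ≤ J` (on `U`, membership in `J(U)` is checked at the localizations `Γ(X,U)_𝔭 = 𝒪_{X,y}`).
[cite: EGAIV3, §10.4 (Jacobson preschemes; the affine-local maximal-ideal criterion behind «très dense»)] -/
theorem le_of_forall_maximal_stalkIdeal_le {I J : X.IdealSheafData}
    (h : ∀ (U : X.affineOpens) (q : PrimeSpectrum Γ(X, U)), q.asIdeal.IsMaximal →
      stalkIdeal I (U.2.fromSpec q) ≤ stalkIdeal J (U.2.fromSpec q)) : I ≤ J := by
  intro U
  refine Ideal.le_of_localization_maximal fun P hP => ?_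
  haveI := hP.isPrime
  -- the point `y ∈ U` of the maximal ideal `P ⊆ Γ(X, U)`
  let q : PrimeSpectrum Γ(X, U) := ⟨P, hP.isPrime⟩
  have hy : U.2.fromSpec q ∈ (U : X.Opens) := U.2.range_fromSpec.le ⟨q, rfl⟩
  letI : Algebra Γ(X, U) (X.presheaf.stalk (U.2.fromSpec q)) :=
    (X.presheaf.germ U (U.2.fromSpec q) hy).hom.toAlgebra
  haveI : IsLocalization.AtPrime (X.presheaf.stalk (U.2.fromSpec q)) P :=
    U.2.isLocalization_stalk' q hy
  -- `𝒪_{X,y}` and `Γ(X, U)_P` are both localizations at `P`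
  let e : Localization.AtPrime P ≃ₐ[Γ(X, U)] X.presheaf.stalk (U.2.fromSpec q) :=
    IsLocalization.algEquiv P.primeCompl _ _
  have key := h U q hP
  rw [stalkIdeal_eq_map_germ I U hy, stalkIdeal_eq_map_germ J U hy] at key
  have key' := Ideal.map_mono (f := e.symm.toAlgHom.toRingHom) key
  rw [Ideal.map_map, Ideal.map_map] at key'
  have hcomp : e.symm.toAlgHom.toRingHom.comp (X.presheaf.germ U (U.2.fromSpec q) hy).hom =
      algebraMap Γ(X, U) (Localization.AtPrime P) :=
    RingHom.ext fun a => e.symm.commutes a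
  rwa [hcomp] at key'

/-- On a Jacobson scheme, the point `U.fromSpec 𝔭` attached to a maximal ideal `𝔭` of the section ring of an
affine open `U` is a CLOSED point of `X` (it is closed in `Spec Γ(X,U) ≅ U`, open in `X`; a locally closed
singleton of a Jacobson space is closed). [cite: EGAIV3, §10.4 (Jacobson preschemes: locally closed points are closed)] -/
theorem mem_closedPoints_fromSpec_of_isMaximal [JacobsonSpace X] (U : X.affineOpens)
    (q : PrimeSpectrum Γ(X, U)) (hq : q.asIdeal.IsMaximal) :
    (U.2.fromSpec q : X) ∈ closedPoints X := by
  have hq' : q ∈ closedPoints (Spec Γ(X, U) : Scheme.{u}) :=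
    (PrimeSpectrum.isClosed_singleton_iff_isMaximal q).mpr hq
  rw [← U.2.fromSpec.isOpenEmbedding.preimage_closedPoints] at hq'
  exact hq'

/-- **On a Jacobson scheme, inclusion of ideal sheaves is checked on the stalks at closed points.**
[cite: EGAIV3, §10.4 (Jacobson preschemes; closed points très dense)] -/
theorem le_of_forall_closedPoint_stalkIdeal_le [JacobsonSpace X] {I J : X.IdealSheafData}
    (h : ∀ x : X, x ∈ closedPoints X → stalkIdeal I x ≤ stalkIdeal J x) : I ≤ J :=
  le_of_forall_maximal_stalkIdeal_le fun U q hq => h _ (mem_closedPoints_fromSpec_of_isMaximal U q hq)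

/-- **On a Jacobson scheme, equality of ideal sheaves is checked on the stalks at closed points.**
[cite: EGAIV3, §10.4 (Jacobson preschemes; closed points très dense)] -/
theorem ext_of_forall_closedPoint_stalkIdeal_eq [JacobsonSpace X] {I J : X.IdealSheafData}
    (h : ∀ x : X, x ∈ closedPoints X → stalkIdeal I x = stalkIdeal J x) : I = J :=
  le_antisymm (le_of_forall_closedPoint_stalkIdeal_le fun x hx => (h x hx).le)
    (le_of_forall_closedPoint_stalkIdeal_le fun x hx => (h x hx).ge)

/-- **On a Jacobson scheme, an ideal sheaf whose stalks at all closed points are the unit ideal is the unit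
ideal sheaf.** [cite: EGAIV3, §10.4 (Jacobson preschemes; closed points très dense)] -/
theorem eq_top_of_forall_closedPoint_stalkIdeal_eq_top [JacobsonSpace X] {I : X.IdealSheafData}
    (h : ∀ x : X, x ∈ closedPoints X → stalkIdeal I x = ⊤) : I = ⊤ :=
  top_le_iff.mp (le_of_forall_closedPoint_stalkIdeal_le fun x hx => by rw [h x hx]; exact le_top)

/-- A scheme locally of finite type over a field is a Jacobson space (Mathlib
`LocallyOfFiniteType.jacobsonSpace`, a field being a Jacobson ring).
[cite: EGAIV3, §10.4 (Cor. 10.4.7: locally of finite type over a Jacobson prescheme is Jacobson)] -/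
theorem jacobsonSpace_of_locallyOfFiniteType_field {K : Type u} [Field K] (f : X ⟶ Spec (.of K))
    [LocallyOfFiniteType f] : JacobsonSpace X :=
  LocallyOfFiniteType.jacobsonSpace f

end Literature.AlgebraicGeometry.Resolution

end
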